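import Summits.CriticalPhenomena.PercolationContinuityZ3.Theorems.PercNearOneGluingNoHeavyLowerTailCubicThreePointGluingCells
import Summits.CriticalPhenomena.PercolationContinuityZ3.Theorems.PercNearOneGluingNoHeavyLowerTailCubicThreePointInduction
import Summits.CriticalPhenomena.PercolationContinuityZ3.Theorems.PercNearOneGluingNoHeavyLowerTailCubicThreePointSeriesParallel
import Mathlib.Tactic.Ring
import Mathlib.Tactic.Linarith
import Mathlib.Tactic.LinearCombination
import HarnessLib

/-!
# `NoHeavyLowerTail` (stmt-CriticalPhenomena-4575) — decoupling across a vertex separator, part 2b: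
# the three-point cells of two pieces glued along the terminals `a, b, c` are the JOIN (parallel composition) of the pieces' cells

Support file (prover prim-sahi-p2, SAHI cell P2; `--supports stmt-CriticalPhenomena-4575`).  No definitions, no named facts, no sorries.
Setting of part 2a (`…CubicThreePointGluingCells`): pieces `(D₁, K₁)`, `(D₂, K₂)` on disjoint random edge sets whose edges (random or forced)
meet only in the terminals (`hsep`); configurations `S₁ ∪ S₂`.
* pointwise: `join_iso_c/b/a` (a terminal isolated in both pieces stays isolated, and the other two are joined iff joined inside one piece —
  part 1's `threeTerm_iso`), `ind_join_Q`, `ind_join_U₁`, `ind_join_U₂`, `ind_join_U₃` (indicator identities of the glued cells);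
* summed (`PrW_union_of_pointwise_mul*`): **`PrW_join_Q`** `q = q₁ q₂`, **`PrW_join_U₁/U₂/U₃`** `uᵢ = q₁ vᵢ + uᵢ⁽¹⁾ q₂ + uᵢ⁽¹⁾ vᵢ`,
  **`PrW_join_T`** (the remaining mass, by `PrW_cells_sum_one`) — exactly the parallel-composition law `z = x ⊔ y` of
  `…CubicThreePointJoinClosure` / the constructor `SPLaw.join` of `…CubicThreePointSeriesParallel` (prim-gen-kcluster), now REALIZED by gluing graphs;
* at the level of kcluster's class `SPLaw` of series–parallel laws (every member satisfies `AG ≥ 0 ∧ max(Ha,Hb) ≥ 0`, hence `Hqt`, AG⁺ and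
  SHK3⁺ = Sahi `E₃ ≥ 0` on the pairwise separations): `SPLaw.swap₂₃/swap₁₃` (terminal symmetry of the class), `splaw_chord` (a piece avoiding `c`
  has law `chord₁`), `splaw_swap12/13`, and **`splaw_join`** (PARALLEL COMPOSITION of two systems meeting only in the terminals stays in `SPLaw`).
  The pendant move is in part 2c (`…GluingPendantCells`); parts 4/6 iterate the moves (class `TSP`; all graphs on ≤ 4 vertices, on 5 without the hub edge).
[cite: Grimmett1999, §2.2 (product measure: independence of disjoint edge sets)]; [cite: GladkovZimin2024HK, §4 (block decomposition)]
-/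

noncomputable section

namespace Summit.CriticalPhenomena.PercolationContinuityZ3.Theorems

/-! ### Terminal symmetries of the class `SPLaw` -/

namespace CubicThreePointJoin

/-- `SPLaw` is invariant under exchanging the cells `ac|b ↔ bc|a` (relabelling `a ↔ b`). [folklore] -/
theorem SPLaw.swap₂₃ {q u₁ u₂ u₃ t : ℝ} (h : SPLaw q u₁ u₂ u₃ t) : SPLaw q u₁ u₃ u₂ t := by
  induction h with
  | chord₁ h₀ h₁ => exact SPLaw.chord₁ h₀ h₁
  | chord₂ h₀ h₁ => exact SPLaw.chord₃ h₀ h₁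
  | chord₃ h₀ h₁ => exact SPLaw.chord₂ h₀ h₁
  | arm₁ h₀ h₁ => exact SPLaw.arm₁ h₀ h₁
  | arm₂ h₀ h₁ => exact SPLaw.arm₃ h₀ h₁
  | arm₃ h₀ h₁ => exact SPLaw.arm₂ h₀ h₁
  | glue h₀ h₁ => exact SPLaw.glue h₀ h₁
  | join _ _ ihx ihy => convert SPLaw.join ihx ihy using 1; ring
  | meet _ _ ihx ihy => convert SPLaw.meet ihx ihy using 1; ring

/-- `SPLaw` is invariant under exchanging the cells `ab|c ↔ bc|a` (relabelling `a ↔ c`). [folklore] -/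
theorem SPLaw.swap₁₃ {q u₁ u₂ u₃ t : ℝ} (h : SPLaw q u₁ u₂ u₃ t) : SPLaw q u₃ u₂ u₁ t := by
  induction h with
  | chord₁ h₀ h₁ => exact SPLaw.chord₃ h₀ h₁
  | chord₂ h₀ h₁ => exact SPLaw.chord₂ h₀ h₁
  | chord₃ h₀ h₁ => exact SPLaw.chord₁ h₀ h₁
  | arm₁ h₀ h₁ => exact SPLaw.arm₃ h₀ h₁
  | arm₂ h₀ h₁ => exact SPLaw.arm₂ h₀ h₁
  | arm₃ h₀ h₁ => exact SPLaw.arm₁ h₀ h₁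
  | glue h₀ h₁ => exact SPLaw.glue h₀ h₁
  | join _ _ ihx ihy => convert SPLaw.join ihx ihy using 1; ring
  | meet _ _ ihx ihy => convert SPLaw.meet ihx ihy using 1; ring

end CubicThreePointJoin

namespace TerminalGluing

open Finset SimpleGraph Literature.Probability.Percolation Literature.Probability.Percolation.DecisionTree CubicThreePointStep
open CubicThreePointTerminal CubicThreePointJoin

variable {V : Type*} [DecidableEq V]

/-! ### JOIN: two pieces meeting only in the terminals `a, b, c` -/

section Join

variable {D₁ D₂ K₁ K₂ : Finset (Sym2 V)} {a b c : V}
  (hsep : ∀ v : V, ∀ e₁ ∈ D₁ ∪ K₁, ∀ e₂ ∈ D₂ ∪ K₂, v ∈ e₁ → v ∈ e₂ → (v = a ∨ v = b ∨ v = c))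
  {S₁ S₂ : Finset (Sym2 V)} (hS₁ : S₁ ⊆ D₁) (hS₂ : S₂ ⊆ D₂)
include hsep hS₁ hS₂

/-- The two piece graphs of a configuration share only terminals. [folklore] -/
theorem join_hT (v u u' : V) (h1 : (fromEdgeSet (↑(S₁ ∪ K₁) : Set (Sym2 V))).Adj v u)
    (h2 : (fromEdgeSet (↑(S₂ ∪ K₂) : Set (Sym2 V))).Adj v u') : (v = a ∨ v = b ∨ v = c) := by
  obtain ⟨e₁, he₁, hv₁, _⟩ := adj_mem_edge hS₁ h1
  obtain ⟨e₂, he₂, hv₂, _⟩ := adj_mem_edge hS₂ h2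
  exact hsep v e₁ he₁ e₂ he₂ hv₁ hv₂

/-- `c` isolated from `a, b` in both pieces ⇒ isolated in the glued configuration, and `a ↔ b` iff inside one piece. [folklore] -/
theorem join_iso_c (hac₁ : ¬ R K₁ S₁ a c) (hbc₁ : ¬ R K₁ S₁ b c) (hac₂ : ¬ R K₂ S₂ a c) (hbc₂ : ¬ R K₂ S₂ b c) :
    (R (K₁ ∪ K₂) (S₁ ∪ S₂) a b ↔ R K₁ S₁ a b ∨ R K₂ S₂ a b) ∧ ¬ R (K₁ ∪ K₂) (S₁ ∪ S₂) a c ∧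
      ¬ R (K₁ ∪ K₂) (S₁ ∪ S₂) b c := by
  have h := threeTerm_iso (join_hT hsep hS₁ hS₂) (not_or.2 ⟨hac₁, hac₂⟩) (not_or.2 ⟨hbc₁, hbc₂⟩)
  simp only [R_union_iff]
  exact h

omit hsep in
/-- The same with `b` isolated (terminals relabelled `(a, c, b)`). [folklore] -/
theorem join_iso_b (hsep : ∀ v : V, ∀ e₁ ∈ D₁ ∪ K₁, ∀ e₂ ∈ D₂ ∪ K₂, v ∈ e₁ → v ∈ e₂ → (v = a ∨ v = b ∨ v = c))
    (hab₁ : ¬ R K₁ S₁ a b) (hcb₁ : ¬ R K₁ S₁ c b) (hab₂ : ¬ R K₂ S₂ a b) (hcb₂ : ¬ R K₂ S₂ c b) :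
    (R (K₁ ∪ K₂) (S₁ ∪ S₂) a c ↔ R K₁ S₁ a c ∨ R K₂ S₂ a c) ∧ ¬ R (K₁ ∪ K₂) (S₁ ∪ S₂) a b ∧
      ¬ R (K₁ ∪ K₂) (S₁ ∪ S₂) c b := by
  have hsep' : ∀ v : V, ∀ e₁ ∈ D₁ ∪ K₁, ∀ e₂ ∈ D₂ ∪ K₂, v ∈ e₁ → v ∈ e₂ → (v = a ∨ v = c ∨ v = b) :=
    fun v e₁ he₁ e₂ he₂ hv₁ hv₂ => by
      rcases hsep v e₁ he₁ e₂ he₂ hv₁ hv₂ with h | h | h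
      · exact Or.inl h
      · exact Or.inr (Or.inr h)
      · exact Or.inr (Or.inl h)
  exact join_iso_c hsep' hS₁ hS₂ hab₁ hcb₁ hab₂ hcb₂

omit hsep in
/-- The same with `a` isolated (terminals relabelled `(b, c, a)`). [folklore] -/
theorem join_iso_a (hsep : ∀ v : V, ∀ e₁ ∈ D₁ ∪ K₁, ∀ e₂ ∈ D₂ ∪ K₂, v ∈ e₁ → v ∈ e₂ → (v = a ∨ v = b ∨ v = c))
    (hba₁ : ¬ R K₁ S₁ b a) (hca₁ : ¬ R K₁ S₁ c a) (hba₂ : ¬ R K₂ S₂ b a) (hca₂ : ¬ R K₂ S₂ c a) :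
    (R (K₁ ∪ K₂) (S₁ ∪ S₂) b c ↔ R K₁ S₁ b c ∨ R K₂ S₂ b c) ∧ ¬ R (K₁ ∪ K₂) (S₁ ∪ S₂) b a ∧
      ¬ R (K₁ ∪ K₂) (S₁ ∪ S₂) c a := by
  have hsep' : ∀ v : V, ∀ e₁ ∈ D₁ ∪ K₁, ∀ e₂ ∈ D₂ ∪ K₂, v ∈ e₁ → v ∈ e₂ → (v = b ∨ v = c ∨ v = a) :=
    fun v e₁ he₁ e₂ he₂ hv₁ hv₂ => by
      rcases hsep v e₁ he₁ e₂ he₂ hv₁ hv₂ with h | h | h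
      · exact Or.inr (Or.inr h)
      · exact Or.inl h
      · exact Or.inr (Or.inl h)
  exact join_iso_c hsep' hS₁ hS₂ hba₁ hca₁ hba₂ hca₂

/-- **Join, cell `a|b|c`** (pointwise): all separated in the glued configuration iff all separated in both pieces. [folklore] -/
theorem ind_join_Q :
    ind (evQ (K₁ ∪ K₂) a b c) (S₁ ∪ S₂) = ind (evQ K₁ a b c) S₁ * ind (evQ K₂ a b c) S₂ := by
  by_cases h : S₁ ∈ evQ K₁ a b c ∧ S₂ ∈ evQ K₂ a b c
  · obtain ⟨⟨hab₁, hac₁, hbc₁⟩, ⟨hab₂, hac₂, hbc₂⟩⟩ := h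
    obtain ⟨hab, hac, hbc⟩ := join_iso_c hsep hS₁ hS₂ hac₁ hbc₁ hac₂ hbc₂
    rw [ind_of_mem (show S₁ ∪ S₂ ∈ evQ (K₁ ∪ K₂) a b c from ⟨fun h' => (hab.1 h').elim hab₁ hab₂, hac, hbc⟩),
      ind_of_mem (show S₁ ∈ evQ K₁ a b c from ⟨hab₁, hac₁, hbc₁⟩),
      ind_of_mem (show S₂ ∈ evQ K₂ a b c from ⟨hab₂, hac₂, hbc₂⟩), mul_one]
  · rw [ind_mul_eq_zero_of_not_and h]
    refine ind_of_not_mem fun hq => h ?_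
    obtain ⟨hab, hac, hbc⟩ := hq
    exact ⟨⟨fun h' => hab (R_union_of_left h'), fun h' => hac (R_union_of_left h'), fun h' => hbc (R_union_of_left h')⟩,
      ⟨fun h' => hab (R_union_of_right h'), fun h' => hac (R_union_of_right h'), fun h' => hbc (R_union_of_right h')⟩⟩

/-- **Join, cell `ab|c`** (pointwise): `c` isolated in both pieces and `a ↔ b` in at least one — three exclusive cases. [folklore] -/
theorem ind_join_U₁ :
    ind (evU₁ (K₁ ∪ K₂) a b c) (S₁ ∪ S₂) =
      ind (evQ K₁ a b c) S₁ * ind (evU₁ K₂ a b c) S₂ + ind (evU₁ K₁ a b c) S₁ * ind (evQ K₂ a b c) S₂ +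
        ind (evU₁ K₁ a b c) S₁ * ind (evU₁ K₂ a b c) S₂ := by
  by_cases hiso : ¬ R K₁ S₁ a c ∧ ¬ R K₁ S₁ b c ∧ ¬ R K₂ S₂ a c ∧ ¬ R K₂ S₂ b c
  · obtain ⟨hac₁, hbc₁, hac₂, hbc₂⟩ := hiso
    obtain ⟨hab, hac, _⟩ := join_iso_c hsep hS₁ hS₂ hac₁ hbc₁ hac₂ hbc₂
    by_cases h1 : R K₁ S₁ a b
    · rw [ind_of_not_mem (fun h : S₁ ∈ evQ K₁ a b c => h.1 h1), ind_of_mem (show S₁ ∈ evU₁ K₁ a b c from ⟨h1, hac₁⟩),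
        ind_of_mem (show S₁ ∪ S₂ ∈ evU₁ (K₁ ∪ K₂) a b c from ⟨hab.2 (Or.inl h1), hac⟩)]
      by_cases h2 : R K₂ S₂ a b
      · rw [ind_of_not_mem (fun h : S₂ ∈ evQ K₂ a b c => h.1 h2), ind_of_mem (show S₂ ∈ evU₁ K₂ a b c from ⟨h2, hac₂⟩)]
        ring
      · rw [ind_of_mem (show S₂ ∈ evQ K₂ a b c from ⟨h2, hac₂, hbc₂⟩), ind_of_not_mem (fun h : S₂ ∈ evU₁ K₂ a b c => h2 h.1)]
        ring
    · rw [ind_of_mem (show S₁ ∈ evQ K₁ a b c from ⟨h1, hac₁, hbc₁⟩), ind_of_not_mem (fun h : S₁ ∈ evU₁ K₁ a b c => h1 h.1)]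
      by_cases h2 : R K₂ S₂ a b
      · rw [ind_of_not_mem (fun h : S₂ ∈ evQ K₂ a b c => h.1 h2), ind_of_mem (show S₂ ∈ evU₁ K₂ a b c from ⟨h2, hac₂⟩),
          ind_of_mem (show S₁ ∪ S₂ ∈ evU₁ (K₁ ∪ K₂) a b c from ⟨hab.2 (Or.inr h2), hac⟩)]
        ring
      · rw [ind_of_mem (show S₂ ∈ evQ K₂ a b c from ⟨h2, hac₂, hbc₂⟩), ind_of_not_mem (fun h : S₂ ∈ evU₁ K₂ a b c => h2 h.1),
          ind_of_not_mem (fun h : S₁ ∪ S₂ ∈ evU₁ (K₁ ∪ K₂) a b c => (hab.1 h.1).elim h1 h2)]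
        ring
  · -- no term survives: the glued cell and every product need `c` isolated on both sides
    have hU : S₁ ∪ S₂ ∉ evU₁ (K₁ ∪ K₂) a b c := by
      rintro ⟨hab, hac⟩
      have hbc : ¬ R (K₁ ∪ K₂) (S₁ ∪ S₂) b c := fun h => hac (hab.trans h)
      exact hiso ⟨fun h => hac (R_union_of_left h), fun h => hbc (R_union_of_left h),
        fun h => hac (R_union_of_right h), fun h => hbc (R_union_of_right h)⟩
    rw [ind_of_not_mem hU]
    rw [ind_mul_eq_zero_of_not_and (fun ⟨hq, hu⟩ => hiso ⟨hq.2.1, hq.2.2, hu.2, fun h => hu.2 (hu.1.trans h)⟩),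
      ind_mul_eq_zero_of_not_and (fun ⟨hu, hq⟩ => hiso ⟨hu.2, fun h => hu.2 (hu.1.trans h), hq.2.1, hq.2.2⟩),
      ind_mul_eq_zero_of_not_and (fun ⟨hu, hu'⟩ => hiso ⟨hu.2, fun h => hu.2 (hu.1.trans h), hu'.2, fun h => hu'.2 (hu'.1.trans h)⟩)]
    ring

/-- **Join, cell `ac|b`** (pointwise). [folklore] -/
theorem ind_join_U₂ :
    ind (evU₂ (K₁ ∪ K₂) a b c) (S₁ ∪ S₂) =
      ind (evQ K₁ a b c) S₁ * ind (evU₂ K₂ a b c) S₂ + ind (evU₂ K₁ a b c) S₁ * ind (evQ K₂ a b c) S₂ +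
        ind (evU₂ K₁ a b c) S₁ * ind (evU₂ K₂ a b c) S₂ := by
  by_cases hiso : ¬ R K₁ S₁ a b ∧ ¬ R K₁ S₁ c b ∧ ¬ R K₂ S₂ a b ∧ ¬ R K₂ S₂ c b
  · obtain ⟨hab₁, hcb₁, hab₂, hcb₂⟩ := hiso
    obtain ⟨hac, hab, _⟩ := join_iso_b hS₁ hS₂ hsep hab₁ hcb₁ hab₂ hcb₂
    by_cases h1 : R K₁ S₁ a c
    · rw [ind_of_not_mem (fun h : S₁ ∈ evQ K₁ a b c => h.2.1 h1), ind_of_mem (show S₁ ∈ evU₂ K₁ a b c from ⟨h1, hab₁⟩),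
        ind_of_mem (show S₁ ∪ S₂ ∈ evU₂ (K₁ ∪ K₂) a b c from ⟨hac.2 (Or.inl h1), hab⟩)]
      by_cases h2 : R K₂ S₂ a c
      · rw [ind_of_not_mem (fun h : S₂ ∈ evQ K₂ a b c => h.2.1 h2), ind_of_mem (show S₂ ∈ evU₂ K₂ a b c from ⟨h2, hab₂⟩)]
        ring
      · rw [ind_of_mem (show S₂ ∈ evQ K₂ a b c from ⟨hab₂, h2, fun h => hcb₂ h.symm⟩),
          ind_of_not_mem (fun h : S₂ ∈ evU₂ K₂ a b c => h2 h.1)]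
        ring
    · rw [ind_of_mem (show S₁ ∈ evQ K₁ a b c from ⟨hab₁, h1, fun h => hcb₁ h.symm⟩),
        ind_of_not_mem (fun h : S₁ ∈ evU₂ K₁ a b c => h1 h.1)]
      by_cases h2 : R K₂ S₂ a c
      · rw [ind_of_not_mem (fun h : S₂ ∈ evQ K₂ a b c => h.2.1 h2), ind_of_mem (show S₂ ∈ evU₂ K₂ a b c from ⟨h2, hab₂⟩),
          ind_of_mem (show S₁ ∪ S₂ ∈ evU₂ (K₁ ∪ K₂) a b c from ⟨hac.2 (Or.inr h2), hab⟩)]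
        ring
      · rw [ind_of_mem (show S₂ ∈ evQ K₂ a b c from ⟨hab₂, h2, fun h => hcb₂ h.symm⟩),
          ind_of_not_mem (fun h : S₂ ∈ evU₂ K₂ a b c => h2 h.1),
          ind_of_not_mem (fun h : S₁ ∪ S₂ ∈ evU₂ (K₁ ∪ K₂) a b c => (hac.1 h.1).elim h1 h2)]
        ring
  · have hU : S₁ ∪ S₂ ∉ evU₂ (K₁ ∪ K₂) a b c := by
      rintro ⟨hac, hab⟩
      have hcb : ¬ R (K₁ ∪ K₂) (S₁ ∪ S₂) c b := fun h => hab (hac.trans h)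
      exact hiso ⟨fun h => hab (R_union_of_left h), fun h => hcb (R_union_of_left h),
        fun h => hab (R_union_of_right h), fun h => hcb (R_union_of_right h)⟩
    rw [ind_of_not_mem hU]
    rw [ind_mul_eq_zero_of_not_and (fun ⟨hq, hu⟩ => hiso ⟨hq.1, fun h => hq.2.2 h.symm, hu.2, fun h => hu.2 (hu.1.trans h)⟩),
      ind_mul_eq_zero_of_not_and (fun ⟨hu, hq⟩ => hiso ⟨hu.2, fun h => hu.2 (hu.1.trans h), hq.1, fun h => hq.2.2 h.symm⟩),
      ind_mul_eq_zero_of_not_and (fun ⟨hu, hu'⟩ => hiso ⟨hu.2, fun h => hu.2 (hu.1.trans h), hu'.2, fun h => hu'.2 (hu'.1.trans h)⟩)]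
    ring

/-- **Join, cell `bc|a`** (pointwise). [folklore] -/
theorem ind_join_U₃ :
    ind (evU₃ (K₁ ∪ K₂) a b c) (S₁ ∪ S₂) =
      ind (evQ K₁ a b c) S₁ * ind (evU₃ K₂ a b c) S₂ + ind (evU₃ K₁ a b c) S₁ * ind (evQ K₂ a b c) S₂ +
        ind (evU₃ K₁ a b c) S₁ * ind (evU₃ K₂ a b c) S₂ := by
  by_cases hiso : ¬ R K₁ S₁ b a ∧ ¬ R K₁ S₁ c a ∧ ¬ R K₂ S₂ b a ∧ ¬ R K₂ S₂ c a
  · obtain ⟨hba₁, hca₁, hba₂, hca₂⟩ := hiso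
    obtain ⟨hbc, hba, _⟩ := join_iso_a hS₁ hS₂ hsep hba₁ hca₁ hba₂ hca₂
    have hab : ¬ R (K₁ ∪ K₂) (S₁ ∪ S₂) a b := fun h => hba h.symm
    by_cases h1 : R K₁ S₁ b c
    · rw [ind_of_not_mem (fun h : S₁ ∈ evQ K₁ a b c => h.2.2 h1),
        ind_of_mem (show S₁ ∈ evU₃ K₁ a b c from ⟨h1, fun h => hba₁ h.symm⟩),
        ind_of_mem (show S₁ ∪ S₂ ∈ evU₃ (K₁ ∪ K₂) a b c from ⟨hbc.2 (Or.inl h1), hab⟩)]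
      by_cases h2 : R K₂ S₂ b c
      · rw [ind_of_not_mem (fun h : S₂ ∈ evQ K₂ a b c => h.2.2 h2),
          ind_of_mem (show S₂ ∈ evU₃ K₂ a b c from ⟨h2, fun h => hba₂ h.symm⟩)]
        ring
      · rw [ind_of_mem (show S₂ ∈ evQ K₂ a b c from ⟨fun h => hba₂ h.symm, fun h => hca₂ h.symm, h2⟩),
          ind_of_not_mem (fun h : S₂ ∈ evU₃ K₂ a b c => h2 h.1)]
        ring
    · rw [ind_of_mem (show S₁ ∈ evQ K₁ a b c from ⟨fun h => hba₁ h.symm, fun h => hca₁ h.symm, h1⟩),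
        ind_of_not_mem (fun h : S₁ ∈ evU₃ K₁ a b c => h1 h.1)]
      by_cases h2 : R K₂ S₂ b c
      · rw [ind_of_not_mem (fun h : S₂ ∈ evQ K₂ a b c => h.2.2 h2),
          ind_of_mem (show S₂ ∈ evU₃ K₂ a b c from ⟨h2, fun h => hba₂ h.symm⟩),
          ind_of_mem (show S₁ ∪ S₂ ∈ evU₃ (K₁ ∪ K₂) a b c from ⟨hbc.2 (Or.inr h2), hab⟩)]
        ring
      · rw [ind_of_mem (show S₂ ∈ evQ K₂ a b c from ⟨fun h => hba₂ h.symm, fun h => hca₂ h.symm, h2⟩),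
          ind_of_not_mem (fun h : S₂ ∈ evU₃ K₂ a b c => h2 h.1),
          ind_of_not_mem (fun h : S₁ ∪ S₂ ∈ evU₃ (K₁ ∪ K₂) a b c => (hbc.1 h.1).elim h1 h2)]
        ring
  · have hU : S₁ ∪ S₂ ∉ evU₃ (K₁ ∪ K₂) a b c := by
      rintro ⟨hbc, hab⟩
      have hca : ¬ R (K₁ ∪ K₂) (S₁ ∪ S₂) c a := fun h => hab (h.symm.trans hbc.symm)
      exact hiso ⟨fun h => hab (R_union_of_left h).symm, fun h => hca (R_union_of_left h),
        fun h => hab (R_union_of_right h).symm, fun h => hca (R_union_of_right h)⟩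
    rw [ind_of_not_mem hU]
    rw [ind_mul_eq_zero_of_not_and (fun ⟨hq, hu⟩ =>
          hiso ⟨fun h => hq.1 h.symm, fun h => hq.2.1 h.symm, fun h => hu.2 h.symm, fun h => hu.2 (h.symm.trans hu.1.symm)⟩),
      ind_mul_eq_zero_of_not_and (fun ⟨hu, hq⟩ =>
          hiso ⟨fun h => hu.2 h.symm, fun h => hu.2 (h.symm.trans hu.1.symm), fun h => hq.1 h.symm, fun h => hq.2.1 h.symm⟩),
      ind_mul_eq_zero_of_not_and (fun ⟨hu, hu'⟩ =>
          hiso ⟨fun h => hu.2 h.symm, fun h => hu.2 (h.symm.trans hu.1.symm), fun h => hu'.2 h.symm,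
            fun h => hu'.2 (h.symm.trans hu'.1.symm)⟩)]
    ring

end Join

/-! ### JOIN: the masses -/

section JoinMasses

variable {D₁ D₂ K₁ K₂ : Finset (Sym2 V)} (p : Sym2 V → ℝ) {a b c : V} (hD : Disjoint D₁ D₂)
  (hsep : ∀ v : V, ∀ e₁ ∈ D₁ ∪ K₁, ∀ e₂ ∈ D₂ ∪ K₂, v ∈ e₁ → v ∈ e₂ → (v = a ∨ v = b ∨ v = c))
include hD hsep

/-- **Join law, cell `a|b|c`**: `q = q₁ · q₂`. [folklore] -/
theorem PrW_join_Q :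
    PrW (D₁ ∪ D₂) p (evQ (K₁ ∪ K₂) a b c) = PrW D₁ p (evQ K₁ a b c) * PrW D₂ p (evQ K₂ a b c) :=
  PrW_union_of_pointwise_mul p hD fun _ _ hS₁ hS₂ => ind_join_Q hsep hS₁ hS₂

/-- **Join law, cell `ab|c`**: `u₁ = q₁ v₁ + u₁⁽¹⁾ q₂ + u₁⁽¹⁾ v₁`. [folklore] -/
theorem PrW_join_U₁ :
    PrW (D₁ ∪ D₂) p (evU₁ (K₁ ∪ K₂) a b c) =
      PrW D₁ p (evQ K₁ a b c) * PrW D₂ p (evU₁ K₂ a b c) + PrW D₁ p (evU₁ K₁ a b c) * PrW D₂ p (evQ K₂ a b c) +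
        PrW D₁ p (evU₁ K₁ a b c) * PrW D₂ p (evU₁ K₂ a b c) :=
  PrW_union_of_pointwise_mul3 p hD fun _ _ hS₁ hS₂ => ind_join_U₁ hsep hS₁ hS₂

/-- **Join law, cell `ac|b`**. [folklore] -/
theorem PrW_join_U₂ :
    PrW (D₁ ∪ D₂) p (evU₂ (K₁ ∪ K₂) a b c) =
      PrW D₁ p (evQ K₁ a b c) * PrW D₂ p (evU₂ K₂ a b c) + PrW D₁ p (evU₂ K₁ a b c) * PrW D₂ p (evQ K₂ a b c) +
        PrW D₁ p (evU₂ K₁ a b c) * PrW D₂ p (evU₂ K₂ a b c) :=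
  PrW_union_of_pointwise_mul3 p hD fun _ _ hS₁ hS₂ => ind_join_U₂ hsep hS₁ hS₂

/-- **Join law, cell `bc|a`**. [folklore] -/
theorem PrW_join_U₃ :
    PrW (D₁ ∪ D₂) p (evU₃ (K₁ ∪ K₂) a b c) =
      PrW D₁ p (evQ K₁ a b c) * PrW D₂ p (evU₃ K₂ a b c) + PrW D₁ p (evU₃ K₁ a b c) * PrW D₂ p (evQ K₂ a b c) +
        PrW D₁ p (evU₃ K₁ a b c) * PrW D₂ p (evU₃ K₂ a b c) :=
  PrW_union_of_pointwise_mul3 p hD fun _ _ hS₁ hS₂ => ind_join_U₃ hsep hS₁ hS₂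

/-- **Join law, cell `abc`**: `t = t₁ + t₂ − t₁ t₂ + Σ_{i ≠ j} uᵢ⁽¹⁾ vⱼ` (the remaining mass). [folklore] -/
theorem PrW_join_T :
    PrW (D₁ ∪ D₂) p (evT (K₁ ∪ K₂) a b c) =
      PrW D₁ p (evT K₁ a b c) + PrW D₂ p (evT K₂ a b c) - PrW D₁ p (evT K₁ a b c) * PrW D₂ p (evT K₂ a b c) +
        (PrW D₁ p (evU₁ K₁ a b c) * (PrW D₂ p (evU₂ K₂ a b c) + PrW D₂ p (evU₃ K₂ a b c)) +
          PrW D₁ p (evU₂ K₁ a b c) * (PrW D₂ p (evU₁ K₂ a b c) + PrW D₂ p (evU₃ K₂ a b c)) +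
          PrW D₁ p (evU₃ K₁ a b c) * (PrW D₂ p (evU₁ K₂ a b c) + PrW D₂ p (evU₂ K₂ a b c))) := by
  have h := PrW_cells_sum_one (D₁ ∪ D₂) p (K₁ ∪ K₂) a b c
  have h₁ := PrW_cells_sum_one D₁ p K₁ a b c
  have h₂ := PrW_cells_sum_one D₂ p K₂ a b c
  rw [PrW_join_Q p hD hsep, PrW_join_U₁ p hD hsep, PrW_join_U₂ p hD hsep, PrW_join_U₃ p hD hsep] at h
  -- eliminate `q₁ = 1 − …` and `q₂ = 1 − …`
  have hq₁ : PrW D₁ p (evQ K₁ a b c) = 1 - PrW D₁ p (evU₁ K₁ a b c) - PrW D₁ p (evU₂ K₁ a b c) -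
      PrW D₁ p (evU₃ K₁ a b c) - PrW D₁ p (evT K₁ a b c) := by linarith
  have hq₂ : PrW D₂ p (evQ K₂ a b c) = 1 - PrW D₂ p (evU₁ K₂ a b c) - PrW D₂ p (evU₂ K₂ a b c) -
      PrW D₂ p (evU₃ K₂ a b c) - PrW D₂ p (evT K₂ a b c) := by linarith
  rw [hq₁, hq₂] at h
  linear_combination h

end JoinMasses

/-! ### The moves at the level of `SPLaw`: chord pieces, relabelling, parallel composition -/

/-- `PrW ≤ 1`. [folklore] -/
theorem PrW_le_one' (D : Finset (Sym2 V)) {p : Sym2 V → ℝ} (hp0 : ∀ i, 0 ≤ p i) (hp1 : ∀ i, p i ≤ 1)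
    (X : Set (Finset (Sym2 V))) : PrW D p X ≤ 1 := by
  rw [← PrW_univ D p]
  exact PrW_mono D hp0 hp1 fun S _ _ => Set.mem_univ S

section Base

variable (D : Finset (Sym2 V)) {K : Finset (Sym2 V)} {p : Sym2 V → ℝ} (hp0 : ∀ i, 0 ≤ p i) (hp1 : ∀ i, p i ≤ 1) {a b c : V}
include hp0 hp1

/-- **Chord / two-terminal blob ⇒ `chord₁` law.**  If no edge contains `c` (and `a, b ≠ c`), the law is `(1 − x, x, 0, 0, 0)` with
`x = P(a ↔ b) ∈ [0,1]`, a member of `SPLaw`. [folklore] -/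
theorem splaw_chord (hc : ∀ e ∈ D ∪ K, c ∉ e) (hac : a ≠ c) (hbc : b ≠ c) :
    SPLaw (PrW D p (evQ K a b c)) (PrW D p (evU₁ K a b c)) (PrW D p (evU₂ K a b c)) (PrW D p (evU₃ K a b c))
      (PrW D p (evT K a b c)) := by
  rw [PrW_chord_Q D p hc hac hbc, PrW_chord_U₂ D p hc hac, PrW_chord_U₃ D p hc hbc, PrW_chord_T D p hc hac]
  exact SPLaw.chord₁ (PrW_nonneg D hp0 hp1 _) (PrW_le_one' D hp0 hp1 _)

omit hp0 hp1 in
/-- Relabelling `a ↔ b` keeps the law in `SPLaw`. [folklore] -/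
theorem splaw_swap12
    (h : SPLaw (PrW D p (evQ K a b c)) (PrW D p (evU₁ K a b c)) (PrW D p (evU₂ K a b c)) (PrW D p (evU₃ K a b c))
      (PrW D p (evT K a b c))) :
    SPLaw (PrW D p (evQ K b a c)) (PrW D p (evU₁ K b a c)) (PrW D p (evU₂ K b a c)) (PrW D p (evU₃ K b a c))
      (PrW D p (evT K b a c)) := by
  rw [evQ_swap12 K a b c, evU₁_swap12 K a b c, evU₂_swap12 K a b c, evU₃_swap12 K a b c, evT_swap12 K a b c]
  exact h.swap₂₃

omit hp0 hp1 in
/-- Relabelling `a ↔ c` keeps the law in `SPLaw`. [folklore] -/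
theorem splaw_swap13
    (h : SPLaw (PrW D p (evQ K a b c)) (PrW D p (evU₁ K a b c)) (PrW D p (evU₂ K a b c)) (PrW D p (evU₃ K a b c))
      (PrW D p (evT K a b c))) :
    SPLaw (PrW D p (evQ K c b a)) (PrW D p (evU₁ K c b a)) (PrW D p (evU₂ K c b a)) (PrW D p (evU₃ K c b a))
      (PrW D p (evT K c b a)) := by
  rw [evQ_swap13 K a b c, evU₁_swap13 K a b c, evU₂_swap13 K a b c, evU₃_swap13 K a b c, evT_swap13 K a b c]
  exact h.swap₁₃

end Base


section JoinMove

variable {D₁ D₂ K₁ K₂ : Finset (Sym2 V)} (p : Sym2 V → ℝ) {a b c : V} (hD : Disjoint D₁ D₂)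
include hD

/-- **Parallel composition of graphs ⇒ join of laws.**  Two systems on disjoint random edge sets meeting only in the terminals, each with a
series–parallel law, glue to a system with the (series–parallel) join law. [folklore] -/
theorem splaw_join (hsep : ∀ v : V, ∀ e₁ ∈ D₁ ∪ K₁, ∀ e₂ ∈ D₂ ∪ K₂, v ∈ e₁ → v ∈ e₂ → (v = a ∨ v = b ∨ v = c))
    (h₁ : SPLaw (PrW D₁ p (evQ K₁ a b c)) (PrW D₁ p (evU₁ K₁ a b c)) (PrW D₁ p (evU₂ K₁ a b c)) (PrW D₁ p (evU₃ K₁ a b c))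
      (PrW D₁ p (evT K₁ a b c)))
    (h₂ : SPLaw (PrW D₂ p (evQ K₂ a b c)) (PrW D₂ p (evU₁ K₂ a b c)) (PrW D₂ p (evU₂ K₂ a b c)) (PrW D₂ p (evU₃ K₂ a b c))
      (PrW D₂ p (evT K₂ a b c))) :
    SPLaw (PrW (D₁ ∪ D₂) p (evQ (K₁ ∪ K₂) a b c)) (PrW (D₁ ∪ D₂) p (evU₁ (K₁ ∪ K₂) a b c))
      (PrW (D₁ ∪ D₂) p (evU₂ (K₁ ∪ K₂) a b c)) (PrW (D₁ ∪ D₂) p (evU₃ (K₁ ∪ K₂) a b c))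
      (PrW (D₁ ∪ D₂) p (evT (K₁ ∪ K₂) a b c)) := by
  obtain ⟨-, -, -, -, -, hσ₁⟩ := h₁.cells
  obtain ⟨-, -, -, -, -, hσ₂⟩ := h₂.cells
  have hj := SPLaw.join h₁ h₂
  rw [PrW_join_Q p hD hsep, PrW_join_U₁ p hD hsep, PrW_join_U₂ p hD hsep, PrW_join_U₃ p hD hsep, PrW_join_T p hD hsep]
  convert hj using 1
  linear_combination (-(PrW D₁ p (evT K₁ a b c))) * hσ₂ + (-(PrW D₂ p (evT K₂ a b c))) * hσ₁

end JoinMove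

end TerminalGluing

end Summit.CriticalPhenomena.PercolationContinuityZ3.Theorems
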